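import Literature.Computability.AlgebraicComplexity.KV20CanonicalEquation
import Literature.Computability.AlgebraicComplexity.KV20UniversalMapIntEvaluatorFP
import HarnessLib

/-!
# Kumar–Volk 2020/2022, Cor 1.3 (M1 programme, brick (P4)-machine, part 2): the entries of the
# evaluation matrix `A = evalMat (uFinFlat n) (n³) (kvGridBound n)` are polynomial-time computable
# integers

Source: M. Kumar, B. L. Volk, *A polynomial degree bound on equations for non-rigid matrices and
small linear circuits*, ACM TOCT 14(2) (2022) art. 6 = arXiv:2003.12938 [KumarVolk2022], §6 = arXiv
§5, proof of Cor 1.3 (p0009:L1–3: the coefficients of `Q_n` by "solving a linear system … in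
polynomial space"). In the cell's reduction of record (val-lit; x5's `KV20CanonicalEquation.lean`:
`KumarVolk2020.kvCanonicalEquation n` = the polynomial whose coefficient vector is
`charpolyKernelVector (AᵀA)` for the EXPLICIT integer matrix
`A = evalMat (uFinFlat n) (n^3) (kvGridBound n)` — rows = grid points `z ∈ {0,…,D}^{2s}` coded by
their base-`(D+1)` digits (`ptOf`), columns = exponent vectors `α ≤ n³` coded by their base-`(n³+1)`
digits (`expOf`), entry `∏_q Ũ_q(z)^{α_q}`), the machine side (the `PSPACE` transducer of (P2)/(P6))
reads the entries of `A` as its `FP` leaves. This file supplies exactly that leaf: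

* §1 the numeric twin: `digit` (base-`B` digits = `finFunctionFinEquiv.symm`), `ptList` (the grid
  point of a row index as a coordinate list), `entryN n r c` (the product of powers of the exact
  evaluations `UEval.uEvalN` of part 1), and **`kvEntry n r c`** = the entry `A r c` with the range
  guard (`0` off the index ranges);
* §2 `eval_uFinFlat_eq_uEvalN`, **`evalMat_uFinFlat_eq_entryN`** (the twin IS the entry:
  `eval_universalMapInt_eq_uEvalN` of part 1 along `rename finSumFinEquiv` / `finProdFinEquiv`, and
  `Fin`-products as `range`-products), `kvEntry_eq`, `kvEntry_of_lt` (on `Fin` indices `kvEntry` IS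
  `evalMat … r c`), and the bit-size bound **`natAbs_kvEntry_le`**
  (`|kvEntry n r c| ≤ 2^{(B + D·Dg)·n³·n²}`, a `poly(n)` exponent: the frame-size datum of the
  transducer; cf. x5's `natAbs_evalEntry_uFin_le` for the `α.support` form);
* §3 **`kvEntryFP : CodeFP (pairE unE (pairE natE natE)) intE (fun w => kvEntry w.1 w.2.1 w.2.2)`** —
  on the input `⟨1ⁿ, ⟨r, c⟩⟩` (`n` unary, the indices binary: they have `poly(n)` bits) the entry is
  computed on codes by a polynomial-time string function, in the tree's integer code `intE`
  (assembled from `UEval.uEvalNFP`, `intPow`, the digit maps and a product fold; typed combinators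
  only);
* §4 (v2) the explicit bit WIDTH `kvEntryWidth n` (an arithmetic expression in `n`),
  **`natAbs_kvEntry_lt_two_pow : |kvEntry n r c| < 2^{kvEntryWidth n}`** and `kvEntryWidthFP`
  (`CodeFP … natE`) — the const-gate width the (P6) circuit of the cell's M1 owner asks for.

Plumbing `def`s only; 0 named facts; census +0. HONEST FRAMING (val-lit): Boolean plumbing for the
machine side of a published CONDITIONAL result's reduction; `kumarVolk2020_cor_1_3` stays open by
name (its hypothesis `hM1` / `coeffBitLanguage kvCanonicalFamily ∈ PSPACE` is untouched here);
`VP ≠ VNP` is NOT proved and nothing in this file bears on it.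

## References

* [KumarVolk2022] M. Kumar, B. L. Volk, ACM TOCT 14(2) (2022) art. 6 = arXiv:2003.12938, §6 /
  arXiv §5 p0009:L1–3 (proof of Cor 1.3), §4.1 (the universal map), Lemma 15 (grid points).
* [AroraBarak2009] S. Arora, B. Barak, *Computational Complexity: A Modern Approach*, CUP 2009,
  §1.3 (polynomial time: composition and polynomially bounded loops), §0.1 (codes).
-/

noncomputable section

namespace Literature.Computability.AlgebraicComplexity

namespace KumarVolk2020

namespace UEval

open MvPolynomial Finset Literature.Computability.Complexity
  Literature.Computability.Complexity.ModArith

/-! ### §1. The numeric twin of the entries -/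

/-- Base-`B` digit `i` of `x` (= coordinate `i` of `finFunctionFinEquiv.symm x`).
[cite: KumarVolk2022, §6 (proof of Cor 1.3, "the list of coefficients")] -/
def digit (B x i : ℕ) : ℕ := x / B ^ i % B

/-- The grid point of the row index `r` as a list of `t` integer coordinates in `{0, …, D}`.
[cite: KumarVolk2022, Lemma 15 (proof)] -/
def ptList (t D r : ℕ) : List ℤ := (List.range t).map fun v => ((digit (D + 1) r v : ℕ) : ℤ)

/-- **The numeric twin of the entry `(r, c)`**: `∏_{q < n²} Ũ_q(z_r)^{α_c(q)}` with the exact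
evaluations of part 1 (`uEvalN`; entry `q` of `Ũ` is the pair `(q / n, q % n)`), the grid point of
`r` and the exponent digits of `c`. [cite: KumarVolk2022, §6 (proof of Cor 1.3)] -/
def entryN (n r c : ℕ) : ℤ :=
  ((List.range (n * n)).map fun q =>
    uEvalN n (corSize n) (ptList (corSize n + corSize n) (kvGridBound n) r) (q / n) (q % n) ^
      digit (n ^ 3 + 1) c q).prod

/-- **The entry function of the evaluation matrix** `A = evalMat (uFinFlat n) (n³) (kvGridBound n)`
on bare indices, `0` off the index ranges `r < (D+1)^{2s}`, `c < (n³+1)^{n²}`.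
[cite: KumarVolk2022, §6 (proof of Cor 1.3)] -/
def kvEntry (n r c : ℕ) : ℤ :=
  if h : r < (kvGridBound n + 1) ^ (corSize n + corSize n) ∧ c < (n ^ 3 + 1) ^ (n * n) then
    evalMat (uFinFlat n) (n ^ 3) (kvGridBound n) ⟨r, h.1⟩ ⟨c, h.2⟩
  else 0

/-! ### §2. The twin is the entry -/

section Semantics

/-- Reading a mapped range. [folklore] -/
private theorem getD_map_range' {α : Type*} (f : ℕ → α) {N a : ℕ} (h : a < N) (d : α) :
    ((List.range N).map f).getD a d = f a := by
  rw [List.getD_eq_getElem?_getD, List.getElem?_map, List.getElem?_range h]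
  rfl

/-- The coordinate list of `r` read through `pt` is x5's `ptOf` along `finSumFinEquiv`.
[cite: KumarVolk2022, Lemma 15 (proof)] -/
theorem pt_ptList (s D : ℕ) {r : ℕ} (hr : r < (D + 1) ^ (s + s)) :
    pt s (ptList (s + s) D r) = ptOf (s + s) D ⟨r, hr⟩ ∘ finSumFinEquiv := by
  funext v
  simp only [pt, ptList, Function.comp_apply, ptOf]
  rw [getD_map_range' _ (finSumFinEquiv v).isLt, finFunctionFinEquiv_symm_apply_val]
  rfl

/-- **The flattened universal map at a coded grid point is the numeric twin**:
`(uFinFlat n)_q(ptOf r) = uEvalN n s (ptList …) (q / n) (q % n)`. [cite: KumarVolk2022, §4.1, §6 (proof of Cor 1.3)] -/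
theorem eval_uFinFlat_eq_uEvalN (n : ℕ) {r : ℕ}
    (hr : r < (kvGridBound n + 1) ^ (corSize n + corSize n)) (q : Fin (n * n)) :
    eval (ptOf (corSize n + corSize n) (kvGridBound n) ⟨r, hr⟩) (uFinFlat n q) =
      uEvalN n (corSize n) (ptList (corSize n + corSize n) (kvGridBound n) r) (q / n) (q % n) := by
  rw [uFinFlat, eval_rename, ← pt_ptList, uFin, finProdFinEquiv_symm_apply,
    eval_universalMapInt_eq_uEvalN]
  rfl

/-- ★ **The evaluation matrix entry is the numeric twin.** [cite: KumarVolk2022, §6 (proof of Cor 1.3)] -/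
theorem evalMat_uFinFlat_eq_entryN (n : ℕ) {r c : ℕ}
    (hr : r < (kvGridBound n + 1) ^ (corSize n + corSize n)) (hc : c < (n ^ 3 + 1) ^ (n * n)) :
    evalMat (uFinFlat n) (n ^ 3) (kvGridBound n) ⟨r, hr⟩ ⟨c, hc⟩ = entryN n r c := by
  unfold evalMat entryN
  rw [prod_map_range, ← Fin.prod_univ_eq_prod_range (fun q =>
    uEvalN n (corSize n) (ptList (corSize n + corSize n) (kvGridBound n) r) (q / n) (q % n) ^
      digit (n ^ 3 + 1) c q) (n * n)]
  refine Finset.prod_congr rfl fun q _ => ?_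
  rw [eval_uFinFlat_eq_uEvalN, expOf_apply, finFunctionFinEquiv_symm_apply_val]
  rfl

/-- `kvEntry` is the guarded twin. [cite: KumarVolk2022, §6 (proof of Cor 1.3)] -/
theorem kvEntry_eq (n r c : ℕ) :
    kvEntry n r c =
      if r < (kvGridBound n + 1) ^ (corSize n + corSize n) ∧ c < (n ^ 3 + 1) ^ (n * n) then
        entryN n r c else 0 := by
  unfold kvEntry
  split_ifs with h
  · exact evalMat_uFinFlat_eq_entryN n h.1 h.2
  · rfl

/-- **On the index ranges `kvEntry` IS the matrix entry** (the form the transducer consumes).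
[cite: KumarVolk2022, §6 (proof of Cor 1.3)] -/
theorem kvEntry_of_lt (n : ℕ) (r : Fin ((kvGridBound n + 1) ^ (corSize n + corSize n)))
    (c : Fin ((n ^ 3 + 1) ^ (n * n))) :
    kvEntry n r c = evalMat (uFinFlat n) (n ^ 3) (kvGridBound n) r c := by
  unfold kvEntry
  rw [dif_pos ⟨r.isLt, c.isLt⟩]

/-- **The entries have polynomial bit-size**: `|kvEntry n r c| ≤ 2^{(B + D·Dg)·(n³·n²)}` with
`B = (s+1)(2s+S²)` (weight exponent of `Ũ`, `weight_uFin_le_two_pow`), `Dg = S(s+1)` (degree of `Ũ`,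
`totalDegree_uFin_le`), `D = kvGridBound n` (coordinates of the grid point), `s = corSize n`,
`S = |USlot n s|` — a `poly(n)` exponent; the frame-size datum the (P2)/(P6) transducer needs.
[cite: KumarVolk2022, §6 (proof of Cor 1.3)] -/
theorem natAbs_kvEntry_le (n r c : ℕ) :
    (kvEntry n r c).natAbs ≤
      2 ^ ((((corSize n + 1) * (2 * corSize n + Fintype.card (USlot n (corSize n)) ^ 2)) +
        kvGridBound n * (Fintype.card (USlot n (corSize n)) * (corSize n + 1))) * (n ^ 3 * (n * n))) := by
  unfold kvEntry
  split_ifs with h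
  · set Bx := (corSize n + 1) * (2 * corSize n + Fintype.card (USlot n (corSize n)) ^ 2) with hBx
    set Dg := Fintype.card (USlot n (corSize n)) * (corSize n + 1) with hDg
    set D := kvGridBound n with hD
    have hz : ∀ v, (ptOf (corSize n + corSize n) D ⟨r, h.1⟩ v).natAbs ≤ D := fun v => natAbs_ptOf_le _ v
    have hfac : ∀ i : Fin (n * n),
        (eval (ptOf (corSize n + corSize n) D ⟨r, h.1⟩) (uFinFlat n i) ^ expOf (n * n) (n ^ 3) ⟨c, h.2⟩ i).natAbs ≤
          (2 ^ Bx * (D + 1) ^ Dg) ^ (n ^ 3) := by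
      intro i
      rw [Int.natAbs_pow]
      have h1 : (eval (ptOf (corSize n + corSize n) D ⟨r, h.1⟩) (uFinFlat n i)).natAbs ≤ 2 ^ Bx * (D + 1) ^ Dg := by
        rw [uFinFlat, eval_rename]
        refine (natAbs_eval_le_weight_mul_pow _ _ (M := D) (fun v => hz _)).trans ?_
        exact Nat.mul_le_mul (weight_uFin_le_two_pow n i)
          (Nat.pow_le_pow_right (Nat.succ_pos _) (totalDegree_uFin_le n i))
      have hb1 : 1 ≤ 2 ^ Bx * (D + 1) ^ Dg :=
        Nat.mul_pos (Nat.one_le_two_pow) (Nat.one_le_pow _ _ (Nat.succ_pos _))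
      exact (Nat.pow_le_pow_left h1 _).trans (Nat.pow_le_pow_right hb1 (expOf_le _ i))
    unfold evalMat
    rw [show (∏ i, eval (ptOf (corSize n + corSize n) D ⟨r, h.1⟩) (uFinFlat n i) ^
        expOf (n * n) (n ^ 3) ⟨c, h.2⟩ i).natAbs = ∏ i, (eval (ptOf (corSize n + corSize n) D ⟨r, h.1⟩)
        (uFinFlat n i) ^ expOf (n * n) (n ^ 3) ⟨c, h.2⟩ i).natAbs from map_prod Int.natAbsHom _ _]
    refine (Finset.prod_le_prod (fun _ _ => Nat.zero_le _) fun i _ => hfac i).trans ?_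
    rw [Finset.prod_const, Finset.card_univ, Fintype.card_fin]
    have hM : (D + 1) ^ Dg ≤ 2 ^ (D * Dg) :=
      calc (D + 1) ^ Dg ≤ (2 ^ D) ^ Dg := Nat.pow_le_pow_left Nat.lt_two_pow_self _
        _ = 2 ^ (D * Dg) := (pow_mul 2 D Dg).symm
    calc ((2 ^ Bx * (D + 1) ^ Dg) ^ (n ^ 3)) ^ (n * n) ≤ ((2 ^ Bx * 2 ^ (D * Dg)) ^ (n ^ 3)) ^ (n * n) :=
          Nat.pow_le_pow_left (Nat.pow_le_pow_left (Nat.mul_le_mul_left _ hM) _) _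
      _ = 2 ^ ((Bx + D * Dg) * (n ^ 3 * (n * n))) := by rw [← pow_add, ← pow_mul, ← pow_mul]
  · simp

end Semantics

/-! ### §3. The entries on codes -/

section Codes

open _root_.Computability Literature.Computability.Complexity.CodeFP Brick

variable {T : Type} {eT : T → List Bool} {nf : T → ℕ}

/-- Unary product (the tree's `unitsMul`). [cite: AroraBarak2009, §1.3] -/
private theorem unMulFP' {f g : T → ℕ} (hf : CodeFP eT unE f) (hg : CodeFP eT unE g) :
    CodeFP eT unE (fun t => f t * g t) :=
  ((ulength unitE).comp (unitsMul.comp ((replicateUnit.comp hf).pair (replicateUnit.comp hg)))).congr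
    fun p => by simp

/-- A unary numeral, read in binary. [folklore] -/
private theorem natOfUn'' {f : T → ℕ} (h : CodeFP eT unE f) : CodeFP eT natE f :=
  (natOfUn.comp h).congr fun _ => rfl

/-- The multiplying fold. [folklore] -/
private theorem foldl_mul_eq_prod_int'' (l : List ℤ) (acc : ℤ) :
    l.foldl (fun acc a => acc * a) acc = acc * l.prod := by
  induction l generalizing acc with
  | nil => simp
  | cons a l ih => rw [List.foldl_cons, ih, List.prod_cons]; ring

/-- `|∏ l| = ∏ |·|`. [folklore] -/
private theorem natAbs_prod'' (l : List ℤ) : l.prod.natAbs = (l.map Int.natAbs).prod := by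
  induction l with
  | nil => simp
  | cons a l ih => rw [List.prod_cons, List.map_cons, List.prod_cons, Int.natAbs_mul, ih]

/-- `size (∏ l) ≤ Σ size + 1`. [folklore] -/
private theorem size_prod_le'' (l : List ℕ) : Nat.size l.prod ≤ (l.map Nat.size).sum + 1 := by
  induction l with
  | nil => simp
  | cons a l ih =>
    rw [List.prod_cons, List.map_cons, List.sum_cons]
    exact (size_mul_le _ _).trans (by omega)

/-- Products of raw integer lists (as in part 1; private to spare an import). [cite: AroraBarak2009, §1.3] -/
private theorem intProd'' : CodeFP (rawE intE) intE List.prod := by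
  have hstep : CodeFP (pairE intE intE) intE (fun t => t.2 * t.1) := (intMul.comp ((snd _ _).pair (fst _ _)) :)
  have h := foldl₀ (step := fun (a : ℤ) acc => acc * a) (b₀ := 1) hstep
    (3 * Polynomial.X + 6) (fun l₁ l₂ => by
      rw [foldl_mul_eq_prod_int'', one_mul]
      simp only [Polynomial.eval_add, Polynomial.eval_mul, Polynomial.eval_X, Polynomial.eval_ofNat]
      set L := (rawE intE (l₁ ++ l₂)).length
      have hsum : ((l₁.map Int.natAbs).map Nat.size).sum ≤ L := by
        rw [List.map_map]
        have h1 : ((l₁ ++ l₂).map fun a => 2 * (intE a).length + 2).sum = L :=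
          (length_rawE intE (l₁ ++ l₂)).symm
        have h2 : (l₁.map (Nat.size ∘ Int.natAbs)).sum ≤ (l₁.map fun a => 2 * (intE a).length + 2).sum :=
          List.sum_le_sum fun z _ => by
            have := size_natAbs_le_length_intE z
            simp only [Function.comp_apply]; omega
        have h3 : (l₁.map fun a => 2 * (intE a).length + 2).sum ≤
            ((l₁ ++ l₂).map fun a => 2 * (intE a).length + 2).sum := by
          rw [List.map_append, List.sum_append]; omega
        omega
      have h1 := length_dpEnc_le l₁.prod
      have h2 : Nat.size l₁.prod.natAbs ≤ L + 1 := by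
        rw [natAbs_prod'']
        exact (size_prod_le'' _).trans (by omega)
      change (dpEnc l₁.prod).length ≤ _
      omega)
  exact h.congr fun l => by rw [foldl_mul_eq_prod_int'', one_mul]

/-- **Digits on codes**: `(B, x, i) ↦ x / B^i % B` with `i` bounded by a unary budget `N ≥ i`.
[cite: AroraBarak2009, §1.3] -/
theorem digitFP {Bf xf i'f Nf : T → ℕ} (hB : CodeFP eT natE Bf) (hx : CodeFP eT natE xf)
    (hi : CodeFP eT natE i'f) (hN : CodeFP eT unE Nf) (hle : ∀ t, i'f t ≤ Nf t) :
    CodeFP eT natE (fun t => digit (Bf t) (xf t) (i'f t)) := by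
  have hiU : CodeFP eT unE (fun t => min (i'f t) (Nf t)) := (unOfNatMin.comp (hN.pair hi) :)
  have hpow : CodeFP eT natE (fun t => Bf t ^ min (i'f t) (Nf t)) := (natPow.comp (hB.pair hiU) :)
  exact ((natMod.comp ((natDiv.comp (hx.pair hpow)).pair hB))).congr fun t => by
    simp only [digit, min_eq_left (hle t)]

/-- `s = corSize n = n² / 200` in unary. [cite: KumarVolk2022, Cor 1.3 (proof: "s < n²/200")] -/
theorem corSizeUFP (hn : CodeFP eT unE nf) : CodeFP eT unE (fun t => corSize (nf t)) := by
  have hnn : CodeFP eT unE (fun t => nf t * nf t) := unMulFP' hn hn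
  have hq : CodeFP eT natE (fun t => nf t * nf t / 200) :=
    (natDiv.comp ((natOfUn'' hnn).pair (const _ (200 : ℕ))) :)
  exact ((unOfNatMin.comp (hnn.pair hq))).congr fun t => by
    simp only [corSize, sq]
    exact min_eq_left (Nat.div_le_self _ _)

/-- `S = |USlot n s| = nS n s` in unary. [cite: AroraBarak2009, §1.3] -/
private theorem nSUFP' {sf : T → ℕ} (hn : CodeFP eT unE nf) (hs : CodeFP eT unE sf) :
    CodeFP eT unE (fun t => nS (nf t) (sf t)) :=
  (unAdd.comp ((unMulFP' hs hn).pair (unAdd.comp ((unMulFP' hs hs).pair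
    (unMulFP' hn (unAdd.comp (hn.pair hs))))))).congr fun _ => rfl

/-- `D = kvGridBound n` in binary. [cite: KumarVolk2022, §6 (proof of Cor 1.3)] -/
theorem kvGridBoundFP (hn : CodeFP eT unE nf) : CodeFP eT natE (fun t => kvGridBound (nf t)) := by
  have hs := corSizeUFP hn
  have hnN := natOfUn'' hn
  have hsN := natOfUn'' hs
  have hS := natOfUn'' (nSUFP' hn hs)
  have h3 : CodeFP eT natE (fun t => nf t ^ 3) := (natPow.comp (hnN.pair (const _ (3 : ℕ))) :)
  exact ((natMul.comp ((natMul.comp ((natMul.comp (hnN.pair hnN)).pair h3)).pair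
    (natMul.comp (hS.pair (natAdd.comp (hsN.pair (const _ (1 : ℕ))))))))).congr fun t => by
    simp only [kvGridBound, ← nS_eq_card]

/-- **The grid point of a row index on codes.** [cite: KumarVolk2022, Lemma 15 (proof)] [cite: AroraBarak2009, §1.3] -/
theorem ptListFP {tf Df rf : T → ℕ} (ht : CodeFP eT unE tf) (hD : CodeFP eT natE Df)
    (hr : CodeFP eT natE rf) : CodeFP eT (rawE intE) (fun t => ptList (tf t) (Df t) (rf t)) := by
  have hD1 : CodeFP (pairE eT natE) natE (fun q => Df q.1 + 1) :=
    (natAdd.comp ((hD.comp (fst _ _)).pair (const _ (1 : ℕ))) :)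
  have hdig : CodeFP (pairE eT natE) natE (fun q => digit (Df q.1 + 1) (rf q.1) (min q.2 (tf q.1))) :=
    digitFP hD1 (hr.comp (fst _ _)) (natOfUn'' (unOfNatMin.comp ((ht.comp (fst _ _)).pair (snd _ _))))
      (ht.comp (fst _ _)) fun q => min_le_right _ _
  have hitem : CodeFP (pairE eT natE) intE (fun q => ((digit (Df q.1 + 1) (rf q.1) (min q.2 (tf q.1)) : ℕ) : ℤ)) :=
    (intOfNat.comp hdig :)
  refine (((CodeFP.map hitem).comp ((CodeFP.id eT).pair (urange.comp ht)))).congr fun t => ?_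
  simp only [ptList, id]
  refine List.map_congr_left fun v hv => ?_
  rw [min_eq_left (List.mem_range.1 hv).le]

/-- The code of the input `⟨1ⁿ, ⟨r, c⟩⟩`. [folklore] -/
abbrev inE : ℕ × ℕ × ℕ → List Bool := pairE unE (pairE natE natE)

/-- **The numeric entry on codes.** [cite: KumarVolk2022, §6 (proof of Cor 1.3)] [cite: AroraBarak2009, §1.3] -/
theorem entryNFP : CodeFP inE intE (fun w => entryN w.1 w.2.1 w.2.2) := by
  have hn : CodeFP inE unE (fun w => w.1) := fst _ _
  have hr : CodeFP inE natE (fun w => w.2.1) := (snd _ _).fst'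
  have hc : CodeFP inE natE (fun w => w.2.2) := (snd _ _).snd'
  have hs : CodeFP inE unE (fun w => corSize w.1) := corSizeUFP hn
  have ht : CodeFP inE unE (fun w => corSize w.1 + corSize w.1) := (unAdd.comp (hs.pair hs) :)
  have hk : CodeFP inE unE (fun w => w.1 * w.1) := unMulFP' hn hn
  have hz : CodeFP inE (rawE intE) (fun w => ptList (corSize w.1 + corSize w.1) (kvGridBound w.1) w.2.1) :=
    ptListFP ht (kvGridBoundFP hn) hr
  have hE1 : CodeFP inE natE (fun w => w.1 ^ 3 + 1) :=
    (natAdd.comp ((natPow.comp ((natOfUn'' hn).pair (const _ (3 : ℕ)))).pair (const _ (1 : ℕ))) :)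
  have hE1U : CodeFP inE unE (fun w => w.1 ^ 3 + 1) :=
    (unSucc.comp (unMulFP' (unMulFP' hn hn) hn)).congr fun w => by ring
  -- item `q = (w, q)`
  have qn : CodeFP (pairE inE natE) natE (fun q => q.1.1) := natOfUn'' (fst _ _).fst'
  have qj : CodeFP (pairE inE natE) natE (fun q => q.2 / q.1.1) := (natDiv.comp ((snd _ _).pair qn) :)
  have qi : CodeFP (pairE inE natE) natE (fun q => q.2 % q.1.1) := (natMod.comp ((snd _ _).pair qn) :)
  have qval : CodeFP (pairE inE natE) intE (fun q =>
      uEvalN q.1.1 (corSize q.1.1) (ptList (corSize q.1.1 + corSize q.1.1) (kvGridBound q.1.1) q.1.2.1)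
        (q.2 / q.1.1) (q.2 % q.1.1)) :=
    uEvalNFP (fst _ _).fst' (hs.comp (fst _ _)) (hz.comp (fst _ _)) qj qi
  have qdig : CodeFP (pairE inE natE) natE (fun q => digit (q.1.1 ^ 3 + 1) q.1.2.2 (min q.2 (q.1.1 * q.1.1))) :=
    digitFP (hE1.comp (fst _ _)) (hc.comp (fst _ _))
      (natOfUn'' (unOfNatMin.comp ((hk.comp (fst _ _)).pair (snd _ _)))) (hk.comp (fst _ _))
      fun q => min_le_right _ _
  have qdigU : CodeFP (pairE inE natE) unE (fun q =>
      min (digit (q.1.1 ^ 3 + 1) q.1.2.2 (min q.2 (q.1.1 * q.1.1))) (q.1.1 ^ 3 + 1)) :=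
    (unOfNatMin.comp ((hE1U.comp (fst _ _)).pair qdig) :)
  have qitem : CodeFP (pairE inE natE) intE (fun q =>
      uEvalN q.1.1 (corSize q.1.1) (ptList (corSize q.1.1 + corSize q.1.1) (kvGridBound q.1.1) q.1.2.1)
        (q.2 / q.1.1) (q.2 % q.1.1) ^
        min (digit (q.1.1 ^ 3 + 1) q.1.2.2 (min q.2 (q.1.1 * q.1.1))) (q.1.1 ^ 3 + 1)) :=
    (intPow.comp (qval.pair qdigU) :)
  refine ((intProd''.comp ((CodeFP.map qitem).comp ((CodeFP.id inE).pair (urange.comp hk))))).congr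
    fun w => ?_
  obtain ⟨n, r, c⟩ := w
  simp only [entryN, id]
  congr 1
  refine List.map_congr_left fun q hq => ?_
  have hq' : q < n * n := List.mem_range.1 hq
  have hd : digit (n ^ 3 + 1) c q ≤ n ^ 3 + 1 := (Nat.mod_lt _ (Nat.succ_pos _)).le
  rw [min_eq_left hq'.le, min_eq_left hd]

/-- ★ **The entries of the evaluation matrix are `FP`**: on `⟨1ⁿ, ⟨r, c⟩⟩` the integer
`kvEntry n r c` (= `evalMat (uFinFlat n) (n³) (kvGridBound n) r c` on the index ranges, `kvEntry_of_lt`;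
`0` off them) is computed on codes by a polynomial-time string function, in the code `intE`.
[cite: KumarVolk2022, §6 (proof of Cor 1.3)] [cite: AroraBarak2009, §1.3] -/
theorem kvEntryFP : CodeFP inE intE (fun w => kvEntry w.1 w.2.1 w.2.2) := by
  have hn : CodeFP inE unE (fun w => w.1) := fst _ _
  have hnN := natOfUn'' hn
  have hr : CodeFP inE natE (fun w => w.2.1) := (snd _ _).fst'
  have hc : CodeFP inE natE (fun w => w.2.2) := (snd _ _).snd'
  have hs : CodeFP inE unE (fun w => corSize w.1) := corSizeUFP hn
  have ht : CodeFP inE unE (fun w => corSize w.1 + corSize w.1) := (unAdd.comp (hs.pair hs) :)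
  have hk : CodeFP inE unE (fun w => w.1 * w.1) := unMulFP' hn hn
  have hDt : CodeFP inE natE (fun w => (kvGridBound w.1 + 1) ^ (corSize w.1 + corSize w.1)) :=
    (natPow.comp ((natAdd.comp ((kvGridBoundFP hn).pair (const _ (1 : ℕ)))).pair ht) :)
  have hEk : CodeFP inE natE (fun w => (w.1 ^ 3 + 1) ^ (w.1 * w.1)) :=
    (natPow.comp ((natAdd.comp ((natPow.comp (hnN.pair (const _ (3 : ℕ)))).pair (const _ (1 : ℕ)))).pair
      hk) :)
  have hguard : CodeFP inE bitE (fun w => decide (w.2.1 < (kvGridBound w.1 + 1) ^ (corSize w.1 + corSize w.1) ∧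
      w.2.2 < (w.1 ^ 3 + 1) ^ (w.1 * w.1))) :=
    ((natLt.comp (hr.pair hDt)).and (natLt.comp (hc.pair hEk))).congr fun w => by
      simp only [Bool.decide_and]
  refine ((hguard.ite entryNFP (const _ (0 : ℤ)))).congr fun w => ?_
  rw [kvEntry_eq]
  by_cases h : w.2.1 < (kvGridBound w.1 + 1) ^ (corSize w.1 + corSize w.1) ∧ w.2.2 < (w.1 ^ 3 + 1) ^ (w.1 * w.1)
  · simp only [h, decide_true, if_true, and_self]
  · simp only [h, decide_false, if_false]
    rfl

end Codes

/-! ### §4. The explicit bit width of the entries (interface datum for the (P6) circuit) -/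

section Width

open _root_.Computability Literature.Computability.Complexity.CodeFP Brick

/-- **The bit width of the entries**, an explicit arithmetic expression in `n`:
`W(n) = (B + D·Dg)·(n³·n²) + 1` with `s = corSize n`, `S = nS n s` (= `|USlot n s|`),
`B = (s+1)(2s+S²)`, `Dg = S(s+1)`, `D = kvGridBound n`. [cite: KumarVolk2022, §6 (proof of Cor 1.3)] -/
def kvEntryWidth (n : ℕ) : ℕ :=
  (((corSize n + 1) * (2 * corSize n + nS n (corSize n) ^ 2)) +
    kvGridBound n * (nS n (corSize n) * (corSize n + 1))) * (n ^ 3 * (n * n)) + 1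

/-- ★ **Every entry has fewer than `kvEntryWidth n` bits**: `|kvEntry n r c| < 2^{W(n)}` (all `r`, `c`;
the const-gate width of the (P6) circuit). [cite: KumarVolk2022, §6 (proof of Cor 1.3)] -/
theorem natAbs_kvEntry_lt_two_pow (n r c : ℕ) : (kvEntry n r c).natAbs < 2 ^ kvEntryWidth n := by
  refine lt_of_le_of_lt (natAbs_kvEntry_le n r c) ?_
  rw [kvEntryWidth, ← nS_eq_card]
  exact Nat.pow_lt_pow_right (by norm_num) (Nat.lt_succ_self _)

variable {T : Type} {eT : T → List Bool} {nf : T → ℕ}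

/-- Unary product (the tree's `unitsMul`). [cite: AroraBarak2009, §1.3] -/
private theorem unMulFP'' {f g : T → ℕ} (hf : CodeFP eT unE f) (hg : CodeFP eT unE g) :
    CodeFP eT unE (fun t => f t * g t) :=
  ((ulength unitE).comp (unitsMul.comp ((replicateUnit.comp hf).pair (replicateUnit.comp hg)))).congr
    fun p => by simp

/-- **The width on codes** (from `1ⁿ`, in binary). [cite: AroraBarak2009, §1.3] -/
theorem kvEntryWidthFP (hn : CodeFP eT unE nf) : CodeFP eT natE (fun t => kvEntryWidth (nf t)) := by
  have hnN : CodeFP eT natE nf := (natOfUn.comp hn).congr fun _ => rfl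
  have hs := corSizeUFP hn
  have hsN : CodeFP eT natE (fun t => corSize (nf t)) := (natOfUn.comp hs).congr fun _ => rfl
  have hSU : CodeFP eT unE (fun t => nS (nf t) (corSize (nf t))) :=
    (unAdd.comp ((unMulFP'' hs hn).pair (unAdd.comp ((unMulFP'' hs hs).pair
      (unMulFP'' hn (unAdd.comp (hn.pair hs))))))).congr fun _ => rfl
  have hS : CodeFP eT natE (fun t => nS (nf t) (corSize (nf t))) := (natOfUn.comp hSU).congr fun _ => rfl
  have hs1 : CodeFP eT natE (fun t => corSize (nf t) + 1) := (natAdd.comp (hsN.pair (const _ (1 : ℕ))) :)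
  have hB : CodeFP eT natE (fun t => (corSize (nf t) + 1) * (2 * corSize (nf t) + nS (nf t) (corSize (nf t)) ^ 2)) :=
    (natMul.comp (hs1.pair (natAdd.comp ((natMul.comp ((const _ (2 : ℕ)).pair hsN)).pair
      (natPow.comp (hS.pair (const _ (2 : ℕ))))))) :)
  have hDDg : CodeFP eT natE (fun t => kvGridBound (nf t) * (nS (nf t) (corSize (nf t)) * (corSize (nf t) + 1))) :=
    (natMul.comp ((kvGridBoundFP hn).pair (natMul.comp (hS.pair hs1))) :)
  have hE : CodeFP eT natE (fun t => nf t ^ 3 * (nf t * nf t)) :=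
    (natMul.comp ((natPow.comp (hnN.pair (const _ (3 : ℕ)))).pair (natMul.comp (hnN.pair hnN))) :)
  exact ((natAdd.comp ((natMul.comp ((natAdd.comp (hB.pair hDDg)).pair hE)).pair (const _ (1 : ℕ))))).congr
    fun _ => rfl

/-- The width from `1ⁿ` alone. [cite: AroraBarak2009, §1.3] -/
theorem kvEntryWidthFP_un : CodeFP unE natE kvEntryWidth :=
  (kvEntryWidthFP (CodeFP.id unE)).congr fun _ => rfl

end Width

end UEval

end KumarVolk2020

end Literature.Computability.AlgebraicComplexity

end
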